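import Mathlib
import Summits.Ventures.PercRepro2.Defs
import Summits.Ventures.PercRepro2.Independence
import Summits.Ventures.PercRepro2.Harris
import Summits.Ventures.PercRepro2.ThreeEventSafe
import Summits.Ventures.PercRepro2.ThreeEventCross
import Summits.Ventures.PercRepro2.ThreeEventCertificate
import Summits.Ventures.PercRepro2.ThreeEventCertificateSwap
import Summits.Ventures.PercRepro2.ThreeEventCertificateInduction
import Summits.Ventures.PercRepro2.ThreeEventAD
import Summits.Ventures.PercRepro2.ThreeEventCertificateAD
import Summits.Ventures.PercRepro2.ThreeEventCertificateSections

/-!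
# The certificate induction BY SECTIONS with Ahlswede–Daykin terms (blind cell PercRepro2, p4 g34;
proofs/P4-G33-CROSS.md §4f, repair R2 of the S3 score)

The Ahlswede–Daykin extension of the section-form certificate induction of
ThreeEventCertificateSections: the pointwise clause is restricted to the support `InSupport p` of the
weight vector (the configurations agreeing with every pinned edge of `p`), the two AD terms
`a_{X,Y}(ω, ω') = 1_D(ω) 1_C(ω') − 1_X(ω) 1_Y(ω')` (meets of `X × Y` in `C`, joins in `D`) enter with
nonnegative coefficients and are summed against the weights of `p[e↦1]` over the whole cube, where
their double sums are nonnegative by the four functions theorem (`ad_double_sum_sym_nonneg`).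
**`cov_inter_le_cov_of_sym_certificates_ad_sec`**: the three-event lemma `Cov(M, B ∩ H) ≤ Cov(G, H)`
for all admissible quadruples MODULO the section form (∃-SYM-AD-sec) — every admissible quadruple,
restricted to every section of the cube, has an unpinned edge with a symmetrised pointwise
certificate made of two admissible instances and two AD terms on that section. No definition, no
instance, no notation.
-/

namespace Summit.Ventures.PercRepro2

namespace ThreeEvent

section Certificate

variable {E : Type*} [Fintype E] [DecidableEq E] {R : Type*} [CommRing R] [LinearOrder R]
  [IsStrictOrderedRing R]

/-- **Symmetrised certificates with two Ahlswede–Daykin terms, on the support.** -/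
theorem crossTerm_ge_of_pointwise_sym_ad_sec {p : E → R} (hp : IsProbVec p) {e : E}
    (he : e ∈ unpinned p)
    (G H M B G₁ H₁ M₁ B₁ G₂ H₂ M₂ B₂ X₁ Y₁ C₁ D₁ X₂ Y₂ C₂ D₂ : Set (Config E))
    (hAD₁ : ∀ a ∈ X₁, ∀ b ∈ Y₁, a ⊓ b ∈ C₁ ∧ a ⊔ b ∈ D₁)
    (hAD₂ : ∀ a ∈ X₂, ∀ b ∈ Y₂, a ⊓ b ∈ C₂ ∧ a ⊔ b ∈ D₂)
    (l₁ l₂ m₁ m₂ : R) (hm₁ : 0 ≤ m₁) (hm₂ : 0 ≤ m₂)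
    (hcert : ∀ ω ω' : Config E, InSupport p ω → InSupport p ω' → ω e = true → ω' e = true →
      l₁ * (pairWt G₁ H₁ M₁ B₁ ω ω' + pairWt G₁ H₁ M₁ B₁ ω' ω)
        + l₂ * (pairWt G₂ H₂ M₂ B₂ ω ω' + pairWt G₂ H₂ M₂ B₂ ω' ω)
        + m₁ * ((D₁.indicator (1 : Config E → R) ω * C₁.indicator 1 ω'
                  - X₁.indicator (1 : Config E → R) ω * Y₁.indicator 1 ω')
                + (D₁.indicator (1 : Config E → R) ω' * C₁.indicator 1 ω
                  - X₁.indicator (1 : Config E → R) ω' * Y₁.indicator 1 ω))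
        + m₂ * ((D₂.indicator (1 : Config E → R) ω * C₂.indicator 1 ω'
                  - X₂.indicator (1 : Config E → R) ω * Y₂.indicator 1 ω')
                + (D₂.indicator (1 : Config E → R) ω' * C₂.indicator 1 ω
                  - X₂.indicator (1 : Config E → R) ω' * Y₂.indicator 1 ω))
        ≤ (pairWt G H M B (Function.update ω e false) ω'
            + pairWt G H M B ω (Function.update ω' e false))
          + (pairWt G H M B (Function.update ω' e false) ω
            + pairWt G H M B ω' (Function.update ω e false))) :
    2 * (l₁ * defect (Function.update p e 1) G₁ H₁ M₁ B₁
      + l₂ * defect (Function.update p e 1) G₂ H₂ M₂ B₂) ≤ 2 * crossTerm p e G H M B := by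
  have hq : IsProbVec (Function.update p e 1) := hp.update e zero_le_one le_rfl
  have hA1 := ad_double_sum_sym_nonneg hq hAD₁
  have hA2 := ad_double_sum_sym_nonneg hq hAD₂
  rw [mul_add, mul_left_comm, mul_left_comm (2 : R), two_mul_defect_eq', two_mul_defect_eq',
    two_mul_crossTerm_eq']
  -- the certificate, summed against the nonnegative weights of `p[e↦1]` (zero off the support),
  -- bounds the cross term by the defects plus the two AD sums, which are nonnegative
  have hsum : ∑ ω, ∑ ω', weight (Function.update p e 1) ω * weight (Function.update p e 1) ω'
        * (l₁ * (pairWt G₁ H₁ M₁ B₁ ω ω' + pairWt G₁ H₁ M₁ B₁ ω' ω)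
          + l₂ * (pairWt G₂ H₂ M₂ B₂ ω ω' + pairWt G₂ H₂ M₂ B₂ ω' ω)
          + m₁ * ((D₁.indicator (1 : Config E → R) ω * C₁.indicator 1 ω'
                    - X₁.indicator (1 : Config E → R) ω * Y₁.indicator 1 ω')
                  + (D₁.indicator (1 : Config E → R) ω' * C₁.indicator 1 ω
                    - X₁.indicator (1 : Config E → R) ω' * Y₁.indicator 1 ω))
          + m₂ * ((D₂.indicator (1 : Config E → R) ω * C₂.indicator 1 ω'
                    - X₂.indicator (1 : Config E → R) ω * Y₂.indicator 1 ω')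
                  + (D₂.indicator (1 : Config E → R) ω' * C₂.indicator 1 ω
                    - X₂.indicator (1 : Config E → R) ω' * Y₂.indicator 1 ω)))
      ≤ ∑ ω, ∑ ω', weight (Function.update p e 1) ω * weight (Function.update p e 1) ω'
          * ((pairWt G H M B (Function.update ω e false) ω'
              + pairWt G H M B ω (Function.update ω' e false))
            + (pairWt G H M B (Function.update ω' e false) ω
              + pairWt G H M B ω' (Function.update ω e false))) := by
    refine Finset.sum_le_sum fun ω _ => Finset.sum_le_sum fun ω' _ => ?_
    have hw : 0 ≤ weight (Function.update p e 1) ω * weight (Function.update p e 1) ω' :=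
      mul_nonneg (weight_nonneg hq ω) (weight_nonneg hq ω')
    by_cases hs : InSupport (Function.update p e 1) ω
    · by_cases hs' : InSupport (Function.update p e 1) ω'
      · obtain ⟨h1, he1⟩ := inSupport_of_inSupport_update_one he hs
        obtain ⟨h2, he2⟩ := inSupport_of_inSupport_update_one he hs'
        exact mul_le_mul_of_nonneg_left (hcert ω ω' h1 h2 he1 he2) hw
      · rw [weight_eq_zero_of_not_inSupport _ hs']
        simp
    · rw [weight_eq_zero_of_not_inSupport _ hs]
      simp
  -- split the left-hand double sum into its four parts
  have hsplit : ∑ ω, ∑ ω', weight (Function.update p e 1) ω * weight (Function.update p e 1) ω'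
        * (l₁ * (pairWt G₁ H₁ M₁ B₁ ω ω' + pairWt G₁ H₁ M₁ B₁ ω' ω)
          + l₂ * (pairWt G₂ H₂ M₂ B₂ ω ω' + pairWt G₂ H₂ M₂ B₂ ω' ω)
          + m₁ * ((D₁.indicator (1 : Config E → R) ω * C₁.indicator 1 ω'
                    - X₁.indicator (1 : Config E → R) ω * Y₁.indicator 1 ω')
                  + (D₁.indicator (1 : Config E → R) ω' * C₁.indicator 1 ω
                    - X₁.indicator (1 : Config E → R) ω' * Y₁.indicator 1 ω))
          + m₂ * ((D₂.indicator (1 : Config E → R) ω * C₂.indicator 1 ω'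
                    - X₂.indicator (1 : Config E → R) ω * Y₂.indicator 1 ω')
                  + (D₂.indicator (1 : Config E → R) ω' * C₂.indicator 1 ω
                    - X₂.indicator (1 : Config E → R) ω' * Y₂.indicator 1 ω)))
      = l₁ * ∑ ω, ∑ ω', weight (Function.update p e 1) ω * weight (Function.update p e 1) ω'
            * (pairWt G₁ H₁ M₁ B₁ ω ω' + pairWt G₁ H₁ M₁ B₁ ω' ω)
        + l₂ * ∑ ω, ∑ ω', weight (Function.update p e 1) ω * weight (Function.update p e 1) ω'
            * (pairWt G₂ H₂ M₂ B₂ ω ω' + pairWt G₂ H₂ M₂ B₂ ω' ω)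
        + m₁ * ∑ ω, ∑ ω', weight (Function.update p e 1) ω * weight (Function.update p e 1) ω'
            * ((D₁.indicator (1 : Config E → R) ω * C₁.indicator 1 ω'
                  - X₁.indicator (1 : Config E → R) ω * Y₁.indicator 1 ω')
                + (D₁.indicator (1 : Config E → R) ω' * C₁.indicator 1 ω
                  - X₁.indicator (1 : Config E → R) ω' * Y₁.indicator 1 ω))
        + m₂ * ∑ ω, ∑ ω', weight (Function.update p e 1) ω * weight (Function.update p e 1) ω'
            * ((D₂.indicator (1 : Config E → R) ω * C₂.indicator 1 ω'
                  - X₂.indicator (1 : Config E → R) ω * Y₂.indicator 1 ω')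
                + (D₂.indicator (1 : Config E → R) ω' * C₂.indicator 1 ω
                  - X₂.indicator (1 : Config E → R) ω' * Y₂.indicator 1 ω)) := by
    simp only [Finset.mul_sum]
    rw [← Finset.sum_add_distrib, ← Finset.sum_add_distrib, ← Finset.sum_add_distrib]
    refine Finset.sum_congr rfl fun ω _ => ?_
    rw [← Finset.sum_add_distrib, ← Finset.sum_add_distrib, ← Finset.sum_add_distrib]
    refine Finset.sum_congr rfl fun ω' _ => ?_
    ring
  rw [hsplit] at hsum
  have := mul_nonneg hm₁ hA1
  have := mul_nonneg hm₂ hA2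
  linarith

end Certificate

section Induction

variable {E : Type*} [Fintype E] [DecidableEq E] {R : Type*} [CommRing R] [LinearOrder R]
  [IsStrictOrderedRing R]

/-- **The certificate induction by sections, with Ahlswede–Daykin terms.** -/
theorem defect_nonneg_of_sym_certificates_ad_sec
    (P : Set (Config E) → Set (Config E) → Set (Config E) → Set (Config E) → Prop)
    (hcert : ∀ (G H M B : Set (Config E)), P G H M B →
      ∀ p : E → R, IsProbVec p → (unpinned p).Nonempty →
        ∃ e ∈ unpinned p, ∃ (G₁ H₁ M₁ B₁ G₂ H₂ M₂ B₂ X₁ Y₁ C₁ D₁ X₂ Y₂ C₂ D₂ : Set (Config E))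
          (l₁ l₂ m₁ m₂ : R),
          P G₁ H₁ M₁ B₁ ∧ P G₂ H₂ M₂ B₂ ∧ 0 ≤ l₁ ∧ 0 ≤ l₂ ∧ 0 ≤ m₁ ∧ 0 ≤ m₂ ∧
          (∀ a ∈ X₁, ∀ b ∈ Y₁, a ⊓ b ∈ C₁ ∧ a ⊔ b ∈ D₁) ∧
          (∀ a ∈ X₂, ∀ b ∈ Y₂, a ⊓ b ∈ C₂ ∧ a ⊔ b ∈ D₂) ∧
          ∀ ω ω' : Config E, InSupport p ω → InSupport p ω' → ω e = true → ω' e = true →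
            l₁ * (pairWt G₁ H₁ M₁ B₁ ω ω' + pairWt G₁ H₁ M₁ B₁ ω' ω)
              + l₂ * (pairWt G₂ H₂ M₂ B₂ ω ω' + pairWt G₂ H₂ M₂ B₂ ω' ω)
              + m₁ * ((D₁.indicator (1 : Config E → R) ω * C₁.indicator 1 ω'
                        - X₁.indicator (1 : Config E → R) ω * Y₁.indicator 1 ω')
                      + (D₁.indicator (1 : Config E → R) ω' * C₁.indicator 1 ω
                        - X₁.indicator (1 : Config E → R) ω' * Y₁.indicator 1 ω))
              + m₂ * ((D₂.indicator (1 : Config E → R) ω * C₂.indicator 1 ω'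
                        - X₂.indicator (1 : Config E → R) ω * Y₂.indicator 1 ω')
                      + (D₂.indicator (1 : Config E → R) ω' * C₂.indicator 1 ω
                        - X₂.indicator (1 : Config E → R) ω' * Y₂.indicator 1 ω))
              ≤ (pairWt G H M B (Function.update ω e false) ω'
                  + pairWt G H M B ω (Function.update ω' e false))
                + (pairWt G H M B (Function.update ω' e false) ω
                  + pairWt G H M B ω' (Function.update ω e false))) :
    ∀ (G H M B : Set (Config E)), P G H M B → ∀ p : E → R, IsProbVec p →
      0 ≤ defect p G H M B := by
  classical
  suffices key : ∀ (n : ℕ) (p : E → R), IsProbVec p → (unpinned p).card = n →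
      ∀ (G H M B : Set (Config E)), P G H M B → 0 ≤ defect p G H M B by
    intro G H M B hP p hp
    exact key _ p hp rfl G H M B hP
  intro n
  induction n using Nat.strong_induction_on with
  | _ n ih =>
    intro p hp hn G H M B hP
    by_cases hne : (unpinned p).Nonempty
    · obtain ⟨e, he, G₁, H₁, M₁, B₁, G₂, H₂, M₂, B₂, X₁, Y₁, C₁, D₁, X₂, Y₂, C₂, D₂, l₁, l₂, m₁, m₂,
        hP₁, hP₂, hl₁, hl₂, hm₁, hm₂, hAD₁, hAD₂, hpt⟩ := hcert G H M B hP p hp hne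
      have ha0 : 0 ≤ p e := hp.nonneg e
      have ha1 : 0 ≤ 1 - p e := sub_nonneg.2 (hp.le_one e)
      have hcard : ((unpinned p).erase e).card < n := by
        rw [← hn]; exact Finset.card_erase_lt_of_mem he
      have hp1 : IsProbVec (Function.update p e 1) := hp.update e zero_le_one le_rfl
      have hp0 : IsProbVec (Function.update p e 0) := hp.update e le_rfl zero_le_one
      have hc1 : (unpinned (Function.update p e 1)).card = ((unpinned p).erase e).card := by
        rw [unpinned_update p he 1 (Or.inr rfl)]
      have hc0 : (unpinned (Function.update p e 0)).card = ((unpinned p).erase e).card := by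
        rw [unpinned_update p he 0 (Or.inl rfl)]
      have h1 : 0 ≤ defect (Function.update p e 1) G H M B := ih _ hcard _ hp1 hc1 G H M B hP
      have h0 : 0 ≤ defect (Function.update p e 0) G H M B := ih _ hcard _ hp0 hc0 G H M B hP
      have hJ1 : 0 ≤ defect (Function.update p e 1) G₁ H₁ M₁ B₁ :=
        ih _ hcard _ hp1 hc1 G₁ H₁ M₁ B₁ hP₁
      have hJ2 : 0 ≤ defect (Function.update p e 1) G₂ H₂ M₂ B₂ :=
        ih _ hcard _ hp1 hc1 G₂ H₂ M₂ B₂ hP₂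
      have hX2 := crossTerm_ge_of_pointwise_sym_ad_sec hp he G H M B G₁ H₁ M₁ B₁ G₂ H₂ M₂ B₂
        X₁ Y₁ C₁ D₁ X₂ Y₂ C₂ D₂ hAD₁ hAD₂ l₁ l₂ m₁ m₂ hm₁ hm₂ hpt
      have hX : 0 ≤ crossTerm p e G H M B := by
        have := mul_nonneg hl₁ hJ1
        have := mul_nonneg hl₂ hJ2
        linarith
      rw [defect_eq_pin_cross p G H M B e]
      have := mul_nonneg (mul_nonneg ha0 ha1) hX
      have := mul_nonneg (pow_nonneg ha0 2) h1
      have := mul_nonneg (pow_nonneg ha1 2) h0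
      linarith
    · have hpin : ∀ e, p e = 0 ∨ p e = 1 := fun e => by
        by_contra hcon
        refine hne ⟨e, ?_⟩
        simp only [unpinned, Finset.mem_filter, Finset.mem_univ, true_and]
        exact ⟨fun h => hcon (Or.inl h), fun h => hcon (Or.inr h)⟩
      rw [defect_eq_zero_of_pinned p hpin]

/-- **The three-event lemma modulo (∃-SYM-AD-sec)**: the section form with Ahlswede–Daykin terms,
for the class of admissible quadruples. -/
theorem cov_inter_le_cov_of_sym_certificates_ad_sec
    (hcert : ∀ (G H M B : Set (Config E)),
      (IsUpperSet G ∧ IsUpperSet H ∧ IsUpperSet M ∧ IsLowerSet B ∧ M ⊆ G ∧ G ∩ B ⊆ M) →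
      ∀ p : E → R, IsProbVec p → (unpinned p).Nonempty →
        ∃ e ∈ unpinned p, ∃ (G₁ H₁ M₁ B₁ G₂ H₂ M₂ B₂ X₁ Y₁ C₁ D₁ X₂ Y₂ C₂ D₂ : Set (Config E))
          (l₁ l₂ m₁ m₂ : R),
          (IsUpperSet G₁ ∧ IsUpperSet H₁ ∧ IsUpperSet M₁ ∧ IsLowerSet B₁ ∧ M₁ ⊆ G₁ ∧ G₁ ∩ B₁ ⊆ M₁)
          ∧ (IsUpperSet G₂ ∧ IsUpperSet H₂ ∧ IsUpperSet M₂ ∧ IsLowerSet B₂ ∧ M₂ ⊆ G₂ ∧ G₂ ∩ B₂ ⊆ M₂)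
          ∧ 0 ≤ l₁ ∧ 0 ≤ l₂ ∧ 0 ≤ m₁ ∧ 0 ≤ m₂ ∧
          (∀ a ∈ X₁, ∀ b ∈ Y₁, a ⊓ b ∈ C₁ ∧ a ⊔ b ∈ D₁) ∧
          (∀ a ∈ X₂, ∀ b ∈ Y₂, a ⊓ b ∈ C₂ ∧ a ⊔ b ∈ D₂) ∧
          ∀ ω ω' : Config E, InSupport p ω → InSupport p ω' → ω e = true → ω' e = true →
            l₁ * (pairWt G₁ H₁ M₁ B₁ ω ω' + pairWt G₁ H₁ M₁ B₁ ω' ω)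
              + l₂ * (pairWt G₂ H₂ M₂ B₂ ω ω' + pairWt G₂ H₂ M₂ B₂ ω' ω)
              + m₁ * ((D₁.indicator (1 : Config E → R) ω * C₁.indicator 1 ω'
                        - X₁.indicator (1 : Config E → R) ω * Y₁.indicator 1 ω')
                      + (D₁.indicator (1 : Config E → R) ω' * C₁.indicator 1 ω
                        - X₁.indicator (1 : Config E → R) ω' * Y₁.indicator 1 ω))
              + m₂ * ((D₂.indicator (1 : Config E → R) ω * C₂.indicator 1 ω'
                        - X₂.indicator (1 : Config E → R) ω * Y₂.indicator 1 ω')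
                      + (D₂.indicator (1 : Config E → R) ω' * C₂.indicator 1 ω
                        - X₂.indicator (1 : Config E → R) ω' * Y₂.indicator 1 ω))
              ≤ (pairWt G H M B (Function.update ω e false) ω'
                  + pairWt G H M B ω (Function.update ω' e false))
                + (pairWt G H M B (Function.update ω' e false) ω
                  + pairWt G H M B ω' (Function.update ω e false)))
    {G H M B : Set (Config E)} (hG : IsUpperSet G) (hH : IsUpperSet H) (hM : IsUpperSet M)
    (hB : IsLowerSet B) (hMG : M ⊆ G) (hGB : G ∩ B ⊆ M) {p : E → R} (hp : IsProbVec p) :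
    prob p (M ∩ (B ∩ H)) - prob p M * prob p (B ∩ H) ≤ prob p (G ∩ H) - prob p G * prob p H :=
  sub_nonneg.1 (defect_nonneg_of_sym_certificates_ad_sec
    (fun G H M B => IsUpperSet G ∧ IsUpperSet H ∧ IsUpperSet M ∧ IsLowerSet B ∧ M ⊆ G ∧ G ∩ B ⊆ M)
    hcert G H M B ⟨hG, hH, hM, hB, hMG, hGB⟩ p hp)

end Induction

end ThreeEvent

end Summit.Ventures.PercRepro2
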